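import Literature.Analysis.FluidPDE.CKNMorreyPressureTerm
import HarnessLib

/-!
# Discharge of `LemarieRieusset2016.lemma13_3_energy` (Lemarié-Rieusset 2016, Lemma 13.3, (13.30))

Analysis/FluidPDE proofs file, sibling of `CKNMorreyLocalEnergySteps.lean` (the named fact
`Literature.Analysis.FluidPDE.LemarieRieusset2016.lemma13_3_energy`: Lemarié-Rieusset 2016,
Lemma 13.3, (13.30), p. 470 — the energy half `U_r + V_r ≤ …` of the local energy and pressure
estimates in the parabolic-Morrey proof of the Caffarelli–Kohn–Nirenberg criterion, Thm. 13.8).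

The printed proof (§13.9, Step 1, pp. 467–470: "Summarizing all those estimates, we have shown:
Lemma 13.3") is assembled in the tree step by step:

* the local energy inequality tested with Scheffer's function (p. 467):
  `step1_testFunctionBound_holds` (`CKNMorreyTestFunctionBound.lean`);
* (13.25) (proved in `CKNMorreyLocalEnergySteps.lean`), (13.26) and (13.27) (p. 468):
  `estimate13_26_holds`, `estimate13_27_holds` (`CKNMorreyLocalEnergyStepsProofs.lean`);
* the pressure term (13.28)–(13.29) (pp. 468–469): `step1_pressureTerm_holds`
  (`CKNMorreyPressureTerm.lean`: Newtonian splitting of the localised pressure in dual form,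
  far-field kernel bound, Calderón–Zygmund part by Stein's `L³` bound, Hölder bookkeeping);
* the summary: `lemma13_3_energy_of_steps` (`CKNMorreyLocalEnergySteps.lean`), specialised to
  `lemma13_3_energy_of_pressureTerm : step1_pressureTerm → lemma13_3_energy`
  (`CKNMorreyLocalEnergyProofs.lean`).

This file records the resulting closed discharge `lemma13_3_energy_holds`. (It cannot be appended
to `CKNMorreyLocalEnergyProofs.lean`: `CKNMorreyPressureTerm` imports that module.)

## References

* P. G. Lemarié-Rieusset, *The Navier–Stokes Problem in the 21st Century*, CRC Press (2016),
  §13.9 Step 1, pp. 467–470; Lemma 13.3, (13.30), p. 470. [LemarieRieusset2016]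
-/

noncomputable section

namespace Literature.Analysis.FluidPDE

namespace LemarieRieusset2016

/-- **(13.30), the energy half of Lemma 13.3, holds** (Lemarié-Rieusset 2016, Lemma 13.3,
(13.30), p. 470): in the standing setting of §13.9 (`IsSuitableOn Ω ν q₀ f u p G`, `ν > 0`,
`1 < q₀ ≤ 3/2`, `Q_{4r₀}(t₀,x₀) ⊆ Ω`, `(t,x) ∈ Q_{r₀}(t₀,x₀)`, `0 < r ≤ ρ/2 ≤ r₀/2`),
`U_r + V_r ≤ C (r³/ρ³) U_ρ + C (ρ^{1/2}/r) (U_ρ + V_ρ) V_ρ^{1/2}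
  + C r⁻¹ ρ^{2 + 3/2 - 5/q₀} P_ρ^{1/q₀} U_ρ^{1/2} + C (U_ρ + V_ρ)^{1/2} F_ρ^{7/10}`, `C = C(ν, q₀)`.
Proof: the test-function bound of p. 467, (13.25)–(13.27) (p. 468) and the pressure term
(13.28)–(13.29) (p. 469) are proved in the tree, and `lemma13_3_energy_of_pressureTerm`
(the summary `lemma13_3_energy_of_steps` fed with them) turns `step1_pressureTerm_holds` into
(13.30). [cite: LemarieRieusset2016, Lemma 13.3 (13.30) p. 470] -/
theorem lemma13_3_energy_holds : lemma13_3_energy :=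
  lemma13_3_energy_of_pressureTerm step1_pressureTerm_holds

end LemarieRieusset2016

end Literature.Analysis.FluidPDE
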